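import Mathlib
import Summits.QuantumFields.YangMills.Theses.DirichletWindow
import Summits.QuantumFields.YangMills.Theorems.ConvexGribovBodyContinuumLegGivenGapStubLock
import HarnessLib

/-!
# `ContinuumFromLatticeGap` (stmt-QuantumFields-15915), line `registered`: `xiLatticeOfXiDiverges`

Support file for the crux item stmt-QuantumFields-15915 (route `GronwallGap`), registered stub
`stub_xiLatticeOfXiDiverges` of the line `registered`: the LATTICE form of `ξ(β) → ∞` — for compact
simple `G`, every `r` and every rate `ε > 0` there is `β₂(ε)` beyond which the torus Wilson theories
do NOT cluster volume-uniformly at rate `ε`, not even with free per-pair constants `C` and free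
per-pair volume thresholds `S₀` — follows from the named open item `DirichletWindow.XiDiverges`
(stmt-8941), taken as a HYPOTHESIS (never proved here).

Proof: the landed `ContinuumLegGivenGap.sharp_eventually_of_xiDiverges` gives `β₁(ε)` beyond which,
for every volume threshold, some pair `(A, B)` beats every constant at rate `ε` at some `S` above
the threshold and some `n ≤ S`. Take the pair at threshold `0`; if the tori clustered at rate `ε`
with per-pair data `(C, S₀)`, absorb that pair's threshold into its constant (below `S₀` there are
finitely many `(S, n)` with `n ≤ S`: enlarge `C` by `∑_{S<S₀} ∑_{n≤S} |corr_S(n)| e^{ε n}`,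
`absorb_threshold`), and the pair's SHARP clause at the enlarged constant is contradicted.

Pure logic and one finite sum over landed tree lemmas; no definitions, no facts. [folklore]
-/

noncomputable section

namespace Summit.QuantumFields.YangMills.Theorems.ContinuumFromLatticeGap

open Filter Topology
open Literature.MathematicalPhysics.QuantumFieldTheory
open Literature.MathematicalPhysics.QuantumLattice
open Summit.QuantumFields.YangMills.Theses

/-- **Per-pair threshold absorption** (the one-pair core of
`ContinuumLegGivenGap.stub_thresholdAbsorption`): an exponential bound `|f S n| ≤ C e^{-m n}` valid
for `S ≥ S₀`, `n ≤ S` extends to ALL `S` and `n ≤ S`, the constant enlarged to `max C D` with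
`D := ∑_{S<S₀} ∑_{n≤S} |f S n| e^{m n}` (finitely many pairs below the threshold). [folklore] -/
theorem absorb_threshold (f : ℕ → ℕ → ℝ) (m C : ℝ) (S₀ : ℕ)
    (h : ∀ S : ℕ, S₀ ≤ S → ∀ n : ℕ, n ≤ S → |f S n| ≤ C * Real.exp (-(m * n))) :
    ∃ C' : ℝ, ∀ S n : ℕ, n ≤ S → |f S n| ≤ C' * Real.exp (-(m * n)) := by
  let D : ℝ := ∑ S ∈ Finset.range S₀, ∑ n ∈ Finset.range (S + 1), |f S n| * Real.exp (m * n)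
  refine ⟨max C D, fun S n hn => ?_⟩
  have hexp : 0 < Real.exp (-(m * n)) := Real.exp_pos _
  by_cases hS : S₀ ≤ S
  · exact (h S hS n hn).trans (mul_le_mul_of_nonneg_right (le_max_left _ _) hexp.le)
  · have hS' : S ∈ Finset.range S₀ := Finset.mem_range.2 (lt_of_not_ge hS)
    have hn' : n ∈ Finset.range (S + 1) := Finset.mem_range.2 (Nat.lt_succ_of_le hn)
    have hterm : |f S n| * Real.exp (m * n) ≤ D := by
      have h1 : |f S n| * Real.exp (m * n) ≤
          ∑ n' ∈ Finset.range (S + 1), |f S n'| * Real.exp (m * n') :=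
        Finset.single_le_sum (f := fun n' => |f S n'| * Real.exp (m * n'))
          (fun n' _ => by positivity) hn'
      refine h1.trans ?_
      exact Finset.single_le_sum (f := fun S' => ∑ n' ∈ Finset.range (S' + 1),
          |f S' n'| * Real.exp (m * n')) (fun S' _ => Finset.sum_nonneg fun n' _ => by positivity)
        hS'
    have hkey : |f S n| = |f S n| * Real.exp (m * n) * Real.exp (-(m * n)) := by
      rw [mul_assoc, ← Real.exp_add, add_neg_cancel, Real.exp_zero, mul_one]
    rw [hkey]
    exact mul_le_mul_of_nonneg_right (hterm.trans (le_max_right _ _)) hexp.le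

/-- **Stub `stub_xiLatticeOfXiDiverges`** (registered stub of stmt-QuantumFields-15915, line
`registered`, reshape 1b): under `DirichletWindow.XiDiverges` (stmt-8941, hypothesis), for compact
simple `G`, every `r : LatticeRep G` and every rate `ε > 0` there is `β₂` such that at every
`β ≥ β₂` the torus Wilson theories do NOT cluster volume-uniformly at rate `ε` with free per-pair
constants and free per-pair volume thresholds: `sharp_eventually_of_xiDiverges` at rate `ε`, the
pair it produces at threshold `0`, and per-pair threshold absorption (`absorb_threshold`).
[folklore] -/
theorem stub_xiLatticeOfXiDiverges :
    DirichletWindow.XiDiverges →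
    ∀ (G : Type) [Group G] [TopologicalSpace G] [IsTopologicalGroup G] [CompactSpace G]
      [MeasurableSpace G] [BorelSpace G], IsCompactSimpleLieGroup G → ∀ r : LatticeRep G,
      ∀ ε : ℝ, 0 < ε → ∃ β₂ : ℝ, ∀ β : ℝ, β₂ ≤ β →
        ¬ (∀ A B : YMSpecies G, ∃ C : ℝ, ∃ S₀ : ℕ, ∀ S : ℕ, S₀ ≤ S → ∀ n : ℕ, n ≤ S →
            |latticeConnectedCorr r.ρ β (2 * S + 1) A.F B.F n| ≤ C * Real.exp (-(ε * n))) := by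
  intro hXi G _ _ _ _ _ _ hG r ε hε
  obtain ⟨β₁, hβ₁⟩ :=
    Summit.QuantumFields.YangMills.Theorems.ContinuumLegGivenGap.sharp_eventually_of_xiDiverges
      hXi hG r ε hε
  refine ⟨β₁, fun β hβ hclust => ?_⟩
  obtain ⟨A, B, hAB⟩ := hβ₁ β hβ 0
  obtain ⟨C, S₀, hC⟩ := hclust A B
  obtain ⟨C', hC'⟩ :=
    absorb_threshold (fun S n => latticeConnectedCorr r.ρ β (2 * S + 1) A.F B.F n) ε C S₀ hC
  obtain ⟨S, n, -, hn, hlt⟩ := hAB C'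
  exact lt_irrefl _ (hlt.trans_le (hC' S n hn))

end Summit.QuantumFields.YangMills.Theorems.ContinuumFromLatticeGap

end
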